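import Literature.NumberTheory.Automorphic.CDTTheorem722
import Literature.NumberTheory.Automorphic.BCDTModularity
import Literature.NumberTheory.Automorphic.BCDTModularityTwistInvarianceProofs
import Literature.NumberTheory.DiophantineGeometry.FreyCurveConductorTwoBadSignProofs
import Literature.NumberTheory.DiophantineGeometry.FreyCurveConductorTwoTwistDichotomyProofs
import Literature.NumberTheory.DiophantineGeometry.GeneralizedFermatTwoPowerCoefficientFreyProofs
import Literature.NumberTheory.DiophantineGeometry.PastenValuationProductsProofs
import Literature.NumberTheory.EllipticCurves.FreyHellegouarchNormalizedCurveProofs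
import HarnessLib

/-!
# Stub ideas k2 GEN 26 for `stub_liftFive` (crux `FreyModularity`, route `DefiniteXi`)

FAMILY 2 — RESHAPE.  Companion of `STUB-IDEAS-stub_liftFive-2.md` (k2 g26).  Statements only
(`def … : Prop`) plus three short sanity proofs; no `sorry`.

* `S2` — the registered stub verbatim (= Rubin CSS XVI Thm. B at `p = 5` = Wiles + Taylor–Wiles +
  Diamond 1996: `E` semistable AT 5 only).
* `S2ss` — the semistable re-cut (`Squarefree N_E`): Wiles 1995 + Taylor–Wiles 1995 at `p = 5`,
  WITHOUT Diamond 1996; `S2 → S2ss` proved (`S2ss_of_S2`).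
* `S2ssFrey` — the consumer cell only (normalised Frey curves, `A ≡ −1 (4)`, `16 ∣ B`);
  `S2ss → S2ssFrey` proved from the tree (`isSemistable_freyCurve_of_sixteen_dvd`,
  `isSemistable_iff_squarefree_conductorNorm`).
* `AtkinLiChi4TwoExactlyDvd` — the ONE new named-fact shape the re-cut needs for the un-normalised
  pairs of case B: Atkin–Li 1978 Thm. 3.1 at `q = 2 ∥ N`, `ψ = χ₄`: the twist of a newform on
  `Γ₀(N)` is a newform on `Γ₀(8N)`.
* `isModular_of_chi4Twist_of_two_exactlyDvd` — twist transport PROVED from that fact (mirror of the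
  landed `IsModular.of_LFunction_eq_twist` / `IsModular.quadraticTwist_neg_one`, which need `N_W` odd).
* `HConductorPartner`, `HCoeffPartner`, `T04`, `TB2Frey` — the Frey instantiation lemmas (each M).
-/

noncomputable section

namespace Summit.ABC.ABC.Cruxes.FreyModularity.StubIdeas.LiftFive2g26

open WeierstrassCurve CongruenceSubgroup
open Literature.NumberTheory.EllipticCurves Literature.NumberTheory.EllipticCurves.ModularForms
  Literature.NumberTheory.DiophantineGeometry Literature.NumberTheory.Automorphic
  Literature.NumberTheory.Automorphic.BCDT Literature.NumberTheory.GaloisRepresentations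

/-! ## A. The stub and its two re-cuts -/

/-- **S2 (verbatim statement of `stub_liftFive`).** [cite: ConradDiamondTaylor1999, Thm. 7.2.2] -/
def S2 : Prop :=
  ∀ (W : WeierstrassCurve ℚ) [W.IsElliptic] (ρ : ModPGaloisRep ℚ (ZMod 5) 2),
    W.IsTorsionGaloisRep 5 ρ → ρ.IsAbsIrreducibleOverSqrt 5 → ¬ 25 ∣ W.conductorNorm ℤ →
    ρ.IsModular → W.IsModularGaloisRepTate 5

/-- **S2_ss — the semistable re-cut** (Wiles 1995 + Taylor–Wiles 1995 at `p = 5`; the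
producer loses Diamond 1996: Rubin CSS XVI Thm. B (p. 464) minus [3] — when `E` is semistable at every prime,
Wiles [19] + Taylor–Wiles [17] alone).  [cite: RubinCSS1997, Thm. B (p. 464)] -/
def S2ss : Prop :=
  ∀ (W : WeierstrassCurve ℚ) [W.IsElliptic] (ρ : ModPGaloisRep ℚ (ZMod 5) 2),
    W.IsTorsionGaloisRep 5 ρ → ρ.IsAbsIrreducibleOverSqrt 5 → Squarefree (W.conductorNorm ℤ) →
    ρ.IsModular → W.IsModularGaloisRepTate 5

/-- `S2 → S2ss`: a squarefree conductor is not divisible by `25 = 5·5`. [folklore] -/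
theorem S2ss_of_S2 (h : S2) : S2ss := by
  intro W _ ρ hρ hirr hsq hmod
  refine h W ρ hρ hirr (fun h25 ↦ ?_) hmod
  have h5 : IsUnit (5 : ℕ) := hsq 5 ((show (5 : ℕ) * 5 = 25 by norm_num) ▸ h25)
  exact absurd (Nat.isUnit_iff.mp h5) (by norm_num)

/-- **S2_ss^Frey — the consumer cell only**: normalised Frey curves `E_(A,B)`, `A ≡ −1 (mod 4)`,
`16 ∣ B` (semistable, `N = rad(AB(A+B))`). [cite: Ribet1997, §2, pp. 10–11] -/
def S2ssFrey : Prop :=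
  ∀ (A B : ℤ) [(freyCurve A B).IsElliptic], IsCoprime A B → A * B * (A + B) ≠ 0 →
    A ≡ -1 [ZMOD 4] → (16 : ℤ) ∣ B →
    ∀ ρ : ModPGaloisRep ℚ (ZMod 5) 2, (freyCurve A B).IsTorsionGaloisRep 5 ρ →
      ρ.IsAbsIrreducibleOverSqrt 5 → ρ.IsModular → (freyCurve A B).IsModularGaloisRepTate 5

/-- `S2ss → S2ssFrey` by the tree's semistability of normalised Frey curves. [folklore] -/
theorem S2ssFrey_of_S2ss (h : S2ss) : S2ssFrey := by
  intro A B _ hAB h0 hA h16 ρ hρ hirr hmod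
  refine h (freyCurve A B) ρ hρ hirr ?_ hmod
  exact ((freyCurve A B).isSemistable_iff_squarefree_conductorNorm).mp
    (isSemistable_freyCurve_of_sixteen_dvd hAB h0 hA h16)

/-! ## B. The one new named fact: Atkin–Li at `2 ∥ N`, `ψ = χ₄` -/

/-- **Atkin–Li 1978, Thm. 3.1, the case `q = 2 ∥ N`, `ψ = χ₄`** (conductor `4 = 2²`): for a newform
`f ∈ S_k(Γ₀(N))` with `2 ∥ N`, the twist `f_{χ₄} = ∑ χ₄(n) aₙ(f) qⁿ` is a NEWFORM on `Γ₀(8N)`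
(local check: `π_{f,2} = St ⊗ η`, `η` unramified quadratic, `a(St ⊗ ηχ₄) = 2·a(χ₄) = 4`, so the
level is `2⁴ · (N/2) = 8N`; `a₂(f_{χ₄}) = 0`).  Named-fact SHAPE to be filed next to the tree's
`atkinLi_twist_newform_of_gamma0` (which only bounds the level from above); the coprime case is the
tree's PROVED `isNewform0_charTwist_of_isPrimePow_of_coprime`. [cite: BestEtAl2021, Lemma 11.2.1(a); AtkinLi1978, Thm. 3.1] -/
def AtkinLiChi4TwoExactlyDvd : Prop :=
  ∀ {N : ℕ} [NeZero N] {k : ℤ} {f : CuspForm (Gamma0 N) k}, IsNewform0 f →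
    2 ∣ N → ¬ 4 ∣ N → ∀ (L : ℕ) [NeZero L] (hN : N ∣ L) (hm : 4 ^ 2 ∣ L), L = 8 * N →
      IsNewform0 (charTwist L hN hm isQuadratic_χ₄_ringHomComp f)

/-- **TB-2 — twist transport across the multiplicative prime `2`** (granted `AtkinLiChi4TwoExactlyDvd`):
`W` modular with `2 ∥ N_W`, `aₙ(W') = χ₄(n) aₙ(W)` for all `n`, `N_{W'} = 8 N_W` ⇒ `W'` modular —
the newform of `W'` is `f_W ⊗ χ₄ ∈ S₂(Γ₀(8 N_W))`.  Mirror of the landed `IsModular.of_LFunction_eq_twist`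
(which needs `(N_W, 4) = 1`). [cite: BestEtAl2021, Lemma 11.2.1(a); AtkinLi1978, Thm. 3.1] -/
theorem isModular_of_chi4Twist_of_two_exactlyDvd (hAL : AtkinLiChi4TwoExactlyDvd)
    {W : WeierstrassCurve ℚ} [NeZero (W.conductorNorm ℤ)] (hW : IsModular W)
    (h2 : 2 ∣ W.conductorNorm ℤ) (h4 : ¬ 4 ∣ W.conductorNorm ℤ)
    (W' : WeierstrassCurve ℚ) [NeZero (W'.conductorNorm ℤ)]
    (hcoeff : ∀ n : ℕ, (W'.LFunction n : ℂ) =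
      (ZMod.χ₄.ringHomComp (Int.castRingHom ℂ)) n * (W.LFunction n : ℂ))
    (hN' : W'.conductorNorm ℤ = 8 * W.conductorNorm ℤ) : IsModular W' := by
  obtain ⟨f, hf⟩ := hW
  haveI : NeZero (8 * W.conductorNorm ℤ) := ⟨mul_ne_zero (by norm_num) (NeZero.ne _)⟩
  have hN : W.conductorNorm ℤ ∣ 8 * W.conductorNorm ℤ := dvd_mul_left _ _
  have hm : 4 ^ 2 ∣ 8 * W.conductorNorm ℤ := by
    obtain ⟨c, hc⟩ := h2
    exact ⟨c, by rw [hc]; ring⟩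
  have hF : IsNewform0 (charTwist (8 * W.conductorNorm ℤ) hN hm isQuadratic_χ₄_ringHomComp f) :=
    hAL hf.1 h2 h4 (8 * W.conductorNorm ℤ) hN hm rfl
  have hFW' : IsNewformOf W' (charTwist (8 * W.conductorNorm ℤ) hN hm isQuadratic_χ₄_ringHomComp f) :=
    ⟨hF, fun n ↦ by
      rw [cuspCoeff_charTwist _ hN hm isQuadratic_χ₄_ringHomComp isPrimitive_χ₄_ringHomComp f n,
        hf.2 n, hcoeff n]⟩
  exact isModular_of_isNewformOf_of_eq W' hFW' hN'.symm

/-! ## C. Frey instantiation (each ≤ one prover cycle) -/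

/-- **H-CondPartner (M, open).** `A ≡ −1 (mod 4)`, `32 ∣ B`, coprime, `AB(A+B) ≠ 0`:
`N(E_(B,A)) = 8 · N(E_(A,B))` — `ord₂`: `4` (`freyCurve_swap` + `conductorExponent_freyCurve_two_eq_four_of_four_dvd`
on `(−A, −B)`) against `1` (`factorization_two_conductorNorm_freyCurve_of_thirtytwo_dvd`); odd part equal
(`factorization_conductorNorm_freyCurve_twist` with `d = 1` on `(A,B)` and `(B,A)`); conclude by
`Nat.eq_of_factorization_eq`. [cite: DiamondKramer1995, Lemma 1 and Lemma 2] -/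
def HConductorPartner : Prop :=
  ∀ A B : ℤ, IsCoprime A B → A * B * (A + B) ≠ 0 → A ≡ -1 [ZMOD 4] → (32 : ℤ) ∣ B →
    (freyCurve B A).conductorNorm ℤ = 8 * (freyCurve A B).conductorNorm ℤ

/-- **H-CoeffPartner (M, open).** `A ≡ −1 (mod 4)`, `16 ∣ B`: `aₙ(E_(B,A)) = χ₄(n) aₙ(E_(A,B))` for all `n`
— `E_(B,A) = E_(A,B)^{(−1)}` (`quadraticTwist_freyCurve_neg_one`) and
`LFunction_quadraticTwist_neg_one_apply_complex`, whose hypothesis `hadd` (the twist is additive at the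
place over `2`) is `f₂(E_(−A,−B)) = 4 ≥ 2` (`freyCurve_swap`, `conductorExponent_freyCurve_two_eq_four_of_four_dvd`,
`two_le_conductorExponent_iff_holds`, bridge `ℤ`-place ↔ `𝓞 ℚ`-place as in
`dvd_conductorNorm_iff_not_hasGoodReductionAt`). [cite: SilvermanAEC2009, X.5 Cor. 5.4] -/
def HCoeffPartner : Prop :=
  ∀ A B : ℤ, IsCoprime A B → A * B * (A + B) ≠ 0 → A ≡ -1 [ZMOD 4] → (16 : ℤ) ∣ B →
    ∀ n : ℕ, (((freyCurve B A).LFunction n : ℤ) : ℂ) =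
      (ZMod.χ₄.ringHomComp (Int.castRingHom ℂ)) n * (((freyCurve A B).LFunction n : ℤ) : ℂ)

/-- **T04 (M, provable NOW from landed lemmas).** Row `16 ∥ B` (`E_(A,B)` good at `2`, `N` odd): the
bad-sign partner `E_(B,A) = E_(A,B)^{(−1)}` (`f₂ = 4`, `N' = 16 N`) is modular if `E_(A,B)` is —
`IsModular.quadraticTwist_neg_one` (c53, landed) with `hodd` from
`factorization_two_conductorNorm_freyCurve_of_sixteen_dvd`, `hN'` as in `HConductorPartner` with `16`.
[cite: BestEtAl2021, Lemma 11.2.1(a); AtkinLi1978, Thm. 3.1] -/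
def T04 : Prop :=
  ∀ (A B : ℤ) [NeZero ((freyCurve A B).conductorNorm ℤ)] [NeZero ((freyCurve B A).conductorNorm ℤ)],
    IsCoprime A B → A * B * (A + B) ≠ 0 → A ≡ -1 [ZMOD 4] → (16 : ℤ) ∣ B → ¬ (32 : ℤ) ∣ B →
    IsModular (freyCurve A B) → IsModular (freyCurve B A)

/-- **TB2^Frey (M given the fact).** Row `32 ∣ B` (`E_(A,B)` multiplicative at `2`, `2 ∥ N`): the partner
`E_(B,A)` (`f₂ = 4`, `N' = 8N`) is modular if `E_(A,B)` is — `isModular_of_chi4Twist_of_two_exactlyDvd`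
+ `HConductorPartner` + `HCoeffPartner` + `2 ∥ N` (`factorization_two_conductorNorm_freyCurve_of_thirtytwo_dvd`).
[cite: BestEtAl2021, Lemma 11.2.1(a); AtkinLi1978, Thm. 3.1] -/
def TB2Frey : Prop :=
  ∀ (A B : ℤ) [NeZero ((freyCurve A B).conductorNorm ℤ)] [NeZero ((freyCurve B A).conductorNorm ℤ)],
    IsCoprime A B → A * B * (A + B) ≠ 0 → A ≡ -1 [ZMOD 4] → (32 : ℤ) ∣ B →
    IsModular (freyCurve A B) → IsModular (freyCurve B A)

/-- The composition `AtkinLi → H-CondPartner → H-CoeffPartner → TB2^Frey` (kernel-checked glue;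
`2 ∥ N(E_(A,B))` from `factorization_two_conductorNorm_freyCurve_of_thirtytwo_dvd`). [folklore] -/
theorem TB2Frey_of (hAL : AtkinLiChi4TwoExactlyDvd) (hN : HConductorPartner) (hC : HCoeffPartner) :
    TB2Frey := by
  intro A B _ _ hAB h0 hA h32 hmod
  have h16 : (16 : ℤ) ∣ B := dvd_trans (by norm_num) h32
  have hfac : ((freyCurve A B).conductorNorm ℤ).factorization 2 = 1 :=
    factorization_two_conductorNorm_freyCurve_of_thirtytwo_dvd hAB h0 hA h32
  have hne : (freyCurve A B).conductorNorm ℤ ≠ 0 := NeZero.ne _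
  have h2 : 2 ∣ (freyCurve A B).conductorNorm ℤ := by
    have h := Nat.ordProj_dvd ((freyCurve A B).conductorNorm ℤ) 2
    rw [hfac, pow_one] at h
    exact h
  have h4 : ¬ 4 ∣ (freyCurve A B).conductorNorm ℤ := by
    intro h
    have h' : 2 ^ 2 ∣ (freyCurve A B).conductorNorm ℤ := by simpa using h
    have := (Nat.prime_two.pow_dvd_iff_le_factorization hne).mp h'
    omega
  exact isModular_of_chi4Twist_of_two_exactlyDvd hAL hmod h2 h4 (freyCurve B A)
    (hC A B hAB h0 hA h16) (hN A B hAB h0 hA h32)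

/-! ## D. The re-cut of case B (lead's act; statement only)

Given `S2ssFrey`, the skeleton's other atoms (`stub_liftThree`-chain `h1`, `stub_switch` `h3`,
`stub_threeImpTwo` = S9), the landed S12 (`stub_freyCaseBSixteen`: case B ⇒ `16 ∣ B` on the normalised
model), S17 (`…StubFreyCaseBAllPairs`: normalisation carrying case B through translations and the
`−1` twist), `isModular_smul_iff` (translations), and the two transports `T04` (row `16 ∥ B`) and
`TB2Frey` (row `32 ∣ B`), every Frey curve in case B is modular.  `CaseBRecut` is that implication with
the skeleton's case-B inputs abstracted exactly as in `isModular_freyCurve_of_stubs`. -/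

/-- **Case B, re-cut** (statement): semistable lifting at `5` on the normalised model + twist transport
replaces `stub_liftFive` (Diamond 1996) in case B.  [cite: ConradDiamondTaylor1999, Thm. 7.1.2 (proof, p. 556)] -/
def CaseBRecut : Prop :=
  S2ssFrey → T04 → TB2Frey →
  -- S9 = (3) ⇒ (2), verbatim as in the skeleton
  (∀ (W : WeierstrassCurve ℚ) [W.IsElliptic] [NeZero (W.conductorNorm ℤ)] (ℓ : ℕ) [Fact ℓ.Prime],
      W.IsModularGaloisRepTate ℓ → IsModular W) →
  -- h1: the `3`-adic chain (case A inputs, used on the switched curve `E'`)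
  (∀ (W : WeierstrassCurve ℚ) [W.IsElliptic] [NeZero (W.conductorNorm ℤ)]
      (ρ : ModPGaloisRep ℚ (ZMod 3) 2), W.IsTorsionGaloisRep 3 ρ →
      ρ.IsAbsIrreducibleOverSqrt (-3) → ¬ 9 ∣ W.conductorNorm ℤ → IsModular W) →
  -- h3: the `3`–`5` switch, verbatim
  (∀ (W : WeierstrassCurve ℚ) [W.IsElliptic], ¬ 27 ∣ W.conductorNorm ℤ →
      (∀ ρ₃ : ModPGaloisRep ℚ (ZMod 3) 2, W.IsTorsionGaloisRep 3 ρ₃ →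
        ¬ ρ₃.IsAbsIrreducibleOverSqrt (-3)) →
      ∀ (ρ : ModPGaloisRep ℚ (ZMod 5) 2), W.IsTorsionGaloisRep 5 ρ → ρ.IsAbsIrreducibleOverSqrt 5 →
      ∃ (W' : WeierstrassCurve ℚ) (_ : W'.IsElliptic), W'.IsTorsionGaloisRep 5 ρ ∧
        ∃ ρ₃' : ModPGaloisRep ℚ (ZMod 3) 2, W'.IsTorsionGaloisRep 3 ρ₃' ∧
          ρ₃'.IsAbsIrreducibleOverSqrt (-3)) →
  ∀ a b : ℤ, IsCoprime a b → a * b * (a + b) ≠ 0 →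
    ∀ [NeZero ((freyCurve a b).conductorNorm ℤ)],
    (∀ ρ₃ : ModPGaloisRep ℚ (ZMod 3) 2, (freyCurve a b).IsTorsionGaloisRep 3 ρ₃ →
      ¬ ρ₃.IsAbsIrreducibleOverSqrt (-3)) →
    IsModular (freyCurve a b)

end Summit.ABC.ABC.Cruxes.FreyModularity.StubIdeas.LiftFive2g26

end
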